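import Literature.AlgebraicGeometry.Motives.HypersurfaceCharts
import Literature.AlgebraicGeometry.Motives.HypersurfaceChartAlgebra
import Literature.AlgebraicGeometry.Motives.ProjectiveClosedSetsForms
import Literature.AlgebraicGeometry.Resolution.PlaneNearPointLemmas
import HarnessLib

/-!
# [OURS · L1 W4.5(b) · EL♮(3) · WIDTH TABLE D3, brick D3-8 (1/2)] The ℙ² conic model certificate of `DirStepUnobs` — ALGEBRA:
# the twisted splitting `H¹(ℙ¹, 𝒪(4)) = 0` at ring level, and the two standard charts of `ℙ²_k` read in `(k[X]_{(X₀X₁)})₀`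

Cell `res-hironaka`, LADDER-RESOLUTION rung L (D-0089), slot W4.5(b), crux chain w45b: child crux **EL♮(3)** = stmt-ResolutionOfSingularities-20148
(`Theses.EquisingularLift.EquisingularLiftNatThree`), parent EL♮ = stmt-…-20038; iso residue of record `stub_elnat_three_isolated_nonNDLeaves` (38th
registration) and its A⁵ = NEST(1) programme (desk R39, WIDTH TABLE D3). WIDTH seat res-L1-w45b-iso-w4 g2 (D-0157 DOOR 1), desk booking D3-8 (STATUS
2026-08-28T17:53:01Z: «the Γ_q CONIC INSTANCE of `DirStepUnobs` as the FIRST CUSTOMER of nose-w1's producer»). `--supports stmt-ResolutionOfSingularities-20148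
--as helper`. OURS; NOT a statement of H. Hironaka's 2017 manuscript (nothing of [Hironaka2017] is asserted); AI-written, and AI review is weaker than
expert review. DEF-FREE; no `sorry`; standard axioms. EL♮(3) is NOT proved here; resolution of singularities in positive characteristic is NOT proved here
(dimension 3 is Cossart–Piltant 2008/2009 in print); counted 0 toward the summit. The scheme-level certificate is the sequel `…NatSpecimenS10ConicUnobs`.

WHAT.
* Part A (any commutative rings): `S10Conic.twisted_splitting` — for ring maps `ι₀, ι₁ : k[y₀, y₁] → B` with `t = ι₀ y₀` a unit of inverse `ti = ι₁ y₀`,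
  `ι₁ y₁ = ι₀ y₁ · ti`, common scalars, and `B = ⋃_N ι₀(k[y])·tiᴺ`: every `γ ∈ B` is `ι₀ α + t²·ι₁ β` modulo `ι₀(y₀ + y₁²)` — the ring-level
  `H¹(ℙ¹, 𝒪(4)) = 0` (`k[τ, τ⁻¹] = k[τ] + τ⁴·k[τ⁻¹]`): modulo the conic `y₁² ≡ −t`, so `ti·y₁^{2s+r} ≡ ±ti tˢ y₁ʳ`, a chart-`0` polynomial for `s ≥ 1` and
  `t²·ι₁(y₀³)`, `t²·ι₁(y₀² y₁)` for `s = 0`; induction on `N` and on the `y₀`-divisible part (Mathlib `divMonomial`/`modMonomial`);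
  `S10Conic.conic_transition`: `ι₀(y₀ + y₁²) = t²·ι₁(y₀ + y₁²)`.
* Part B (the model rings `(k[X₀,X₁,X₂]_{(Xᵢ)})₀ → (k[X]_{(X₀X₁)})₀`, Mathlib `HomogeneousLocalization.Away` / `awayMap`, the tree's
  `ProjectiveSpace.toChart`): the relations `t_mul_ti` (`(X₁²/X₀X₁)(X₀²/X₀X₁) = 1`), `awayMap₀_toChart_X_zero`, `awayMap₁_toChart_X_zero`,
  `awayMap₁_toChart_X_one`, `awayMap_toChart_C`, and the generation `exists_eq_awayMap₀_mul_pow` (`a/(X₀X₁)ᴺ = (a/X₀²ᴺ)·(X₀²/X₀X₁)ᴺ`).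
* Part B′ (the conic `F = X₀X₁ + X₂²`): `isHomogeneous_conic`, `dehomogenize_zero_conic` / `dehomogenize_one_conic` (`F(xᵢ := 1) = y₀ + y₁²`, `i = 0, 1`),
  `chartEqn_conic_eq` (`F/Xᵢ² = toChart(y₀ + y₁²)`), `isPrime_span_conic` (the kernel of `y₀ ↦ −T², y₁ ↦ T`, the tree's `ker_aeval_vecCons_X`),
  `isPrime_span_toChart_conic`, `eq_zero_of_toChart_conic_mul_eq_zero` (non-zero-divisor), `zeroLocus_conic_subset` (`V₊(F) ⊆ D₊(X₀) ∪ D₊(X₁)`: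
  a point containing `X₀, X₁` contains `X₂² = F − X₀X₁`, hence the irrelevant ideal).
DICTIONARY for the S10 customer (res-L1-w45b-lead-1 l.82605 «Γ_q charts Eq.y/Eq.z»): `(X₀, X₁, X₂) = (y₁, z₁, x₁)`, `Γ_q = {x₁² + y₁z₁ = 0} = V₊(X₀X₁ + X₂²)`,
`Eq.y = D₊(X₀)`, `Eq.z = D₊(X₁)`; on `Γ_q ≅ ℙ¹` the transition `(X₁/X₀)²|` is `τ⁴` (`𝒩 ≅ 𝒪(4)`).

References (method / index only): R. Hartshorne, *Algebraic Geometry* (1977), I Thm. 3.4 (proof), II Prop. 2.5 (b), III.5 [cite: Hartshorne1977].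
-/

set_option linter.dupNamespace false

noncomputable section

-- `Proj`/`ProjectiveSpectrum` carrier coercions and `Fin (1 + 2) = Fin 3` under `instances` transparency (as in the chain's other chart files).
set_option backward.isDefEq.respectTransparency false

open AlgebraicGeometry MvPolynomial HomogeneousLocalization

namespace Summit.ResolutionOfSingularities.ResolutionOfSingularities.Cruxes.EquisingularLiftNat.Sections

namespace S10Conic

/-! ### Part A. The twisted splitting `B = ι₀ k[y] + t²·ι₁ k[y] + (ι₀(y₀ + y₁²))`, abstractly

`B` a commutative ring with two ring maps `ι₀, ι₁ : k[y₀, y₁] → B` (the two charts read in the overlap ring), `t = ι₀ y₀` a unit with inverse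
`ti = ι₁ y₀`, `ι₁ y₁ = ι₀ y₁ · ti`, the same scalars, and every element of `B` of the form `ι₀(p)·tiᴺ`.  Then every `γ ∈ B` is
`ι₀ α + t² ι₁ β` modulo the conic `ι₀(y₀ + y₁²)` — the ring-level form of `H¹(ℙ¹, 𝒪(4)) = 0` (`k[τ, τ⁻¹] = k[τ] + τ⁴ k[τ⁻¹]`). -/

section Split

variable {k B : Type*} [CommRing k] [CommRing B] (ι₀ ι₁ : MvPolynomial (Fin 2) k →+* B) (t ti : B)

/-- Splitting elements add. -/
private theorem split_add {x y : B}
    (hx : ∃ α β : MvPolynomial (Fin 2) k, x - (ι₀ α + t ^ 2 * ι₁ β) ∈ Ideal.span {ι₀ (X 0 + X 1 ^ 2)})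
    (hy : ∃ α β : MvPolynomial (Fin 2) k, y - (ι₀ α + t ^ 2 * ι₁ β) ∈ Ideal.span {ι₀ (X 0 + X 1 ^ 2)}) :
    ∃ α β : MvPolynomial (Fin 2) k, x + y - (ι₀ α + t ^ 2 * ι₁ β) ∈ Ideal.span {ι₀ (X 0 + X 1 ^ 2)} := by
  obtain ⟨α, β, h⟩ := hx
  obtain ⟨α', β', h'⟩ := hy
  refine ⟨α + α', β + β', ?_⟩
  have : x + y - (ι₀ (α + α') + t ^ 2 * ι₁ (β + β')) =
      (x - (ι₀ α + t ^ 2 * ι₁ β)) + (y - (ι₀ α' + t ^ 2 * ι₁ β')) := by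
    simp only [map_add]; ring
  rw [this]
  exact Ideal.add_mem _ h h'

/-- Splitting is invariant modulo the conic. -/
private theorem split_of_sub_mem {x y : B}
    (hy : ∃ α β : MvPolynomial (Fin 2) k, y - (ι₀ α + t ^ 2 * ι₁ β) ∈ Ideal.span {ι₀ (X 0 + X 1 ^ 2)})
    (h : x - y ∈ Ideal.span {ι₀ (X 0 + X 1 ^ 2)}) :
    ∃ α β : MvPolynomial (Fin 2) k, x - (ι₀ α + t ^ 2 * ι₁ β) ∈ Ideal.span {ι₀ (X 0 + X 1 ^ 2)} := by
  obtain ⟨α, β, hy⟩ := hy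
  refine ⟨α, β, ?_⟩
  have : x - (ι₀ α + t ^ 2 * ι₁ β) = (x - y) + (y - (ι₀ α + t ^ 2 * ι₁ β)) := by ring
  rw [this]
  exact Ideal.add_mem _ h hy

/-- Splitting elements are stable under the common scalars. -/
private theorem split_C_mul (hC : ∀ c : k, ι₁ (C c) = ι₀ (C c)) {x : B} (c : k)
    (hx : ∃ α β : MvPolynomial (Fin 2) k, x - (ι₀ α + t ^ 2 * ι₁ β) ∈ Ideal.span {ι₀ (X 0 + X 1 ^ 2)}) :
    ∃ α β : MvPolynomial (Fin 2) k, ι₀ (C c) * x - (ι₀ α + t ^ 2 * ι₁ β) ∈ Ideal.span {ι₀ (X 0 + X 1 ^ 2)} := by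
  obtain ⟨α, β, h⟩ := hx
  refine ⟨C c * α, C c * β, ?_⟩
  have : ι₀ (C c) * x - (ι₀ (C c * α) + t ^ 2 * ι₁ (C c * β)) = ι₀ (C c) * (x - (ι₀ α + t ^ 2 * ι₁ β)) := by
    rw [map_mul, map_mul, hC]; ring
  rw [this]
  exact Ideal.mul_mem_left _ _ h

/-- Finite sums of splitting elements split. -/
private theorem split_sum {ι : Type*} (s : Finset ι) (f : ι → B)
    (hf : ∀ i ∈ s, ∃ α β : MvPolynomial (Fin 2) k, f i - (ι₀ α + t ^ 2 * ι₁ β) ∈ Ideal.span {ι₀ (X 0 + X 1 ^ 2)}) :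
    ∃ α β : MvPolynomial (Fin 2) k, (∑ i ∈ s, f i) - (ι₀ α + t ^ 2 * ι₁ β) ∈ Ideal.span {ι₀ (X 0 + X 1 ^ 2)} := by
  classical
  induction s using Finset.induction_on with
  | empty => exact ⟨0, 0, by simp⟩
  | insert a s ha ih =>
    rw [Finset.sum_insert ha]
    exact split_add ι₀ ι₁ t (hf a (Finset.mem_insert_self a s)) (ih fun i hi => hf i (Finset.mem_insert_of_mem hi))

variable (h0 : ι₀ (X 0) = t) (h2 : ι₁ (X 0) = ti) (h3 : ι₁ (X 1) = ι₀ (X 1) * ti) (hti : t * ti = 1)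
include h0 h2 h3 hti

/-- `ti · ι₀(y₁ᶜ)` splits: with `w = ι₀ y₁`, `w² ≡ −t` modulo the conic, so `ti w^{2s+r} ≡ (−1)ˢ ti tˢ wʳ`, which is `ι₀((−1)ˢ y₀^{s−1} y₁ʳ)`
for `s ≥ 1`, and `t² ι₁(y₀³)` resp. `t² ι₁(y₀² y₁)` for `s = 0`, `r = 0, 1`. -/
private theorem split_ti_mul_X_pow (c : ℕ) :
    ∃ α β : MvPolynomial (Fin 2) k, ti * ι₀ (X 1 ^ c) - (ι₀ α + t ^ 2 * ι₁ β) ∈ Ideal.span {ι₀ (X 0 + X 1 ^ 2)} := by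
  set w := ι₀ (X 1) with hw
  have hg : ι₀ (X 0 + X 1 ^ 2) = w ^ 2 - (-t) := by rw [map_add, map_pow, h0]; ring
  obtain ⟨s, r, hr, rfl⟩ : ∃ s r, r < 2 ∧ c = 2 * s + r :=
    ⟨c / 2, c % 2, Nat.mod_lt c two_pos, (Nat.div_add_mod c 2).symm⟩
  have hred : ti * ι₀ (X 1 ^ (2 * s + r)) - ti * ((-t) ^ s * w ^ r) ∈ Ideal.span {ι₀ (X 0 + X 1 ^ 2)} := by
    rw [map_pow, ← hw, pow_add, pow_mul, hg]
    have : ti * ((w ^ 2) ^ s * w ^ r) - ti * ((-t) ^ s * w ^ r) = ti * w ^ r * ((w ^ 2) ^ s - (-t) ^ s) := by ring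
    rw [this]
    exact Ideal.mul_mem_left _ _ (Ideal.mem_span_singleton.2 (sub_dvd_pow_sub_pow _ _ s))
  refine split_of_sub_mem ι₀ ι₁ t ?_ hred
  rcases Nat.eq_zero_or_pos s with rfl | hs
  · interval_cases r
    · refine ⟨0, X 0 ^ 3, ?_⟩
      have : ti * ((-t) ^ 0 * w ^ 0) - (ι₀ 0 + t ^ 2 * ι₁ (X 0 ^ 3)) = 0 := by
        rw [map_pow, h2, map_zero]; linear_combination (-ti * (1 + t * ti)) * hti
      rw [this]; exact Ideal.zero_mem _
    · refine ⟨0, X 0 ^ 2 * X 1, ?_⟩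
      have : ti * ((-t) ^ 0 * w ^ 1) - (ι₀ 0 + t ^ 2 * ι₁ (X 0 ^ 2 * X 1)) = 0 := by
        rw [map_mul, map_pow, h2, h3, map_zero]; linear_combination (-(ti * w) * (1 + t * ti)) * hti
      rw [this]; exact Ideal.zero_mem _
  · obtain ⟨s', rfl⟩ := Nat.exists_eq_add_of_le' hs
    refine ⟨(-1) ^ (s' + 1) * X 0 ^ s' * X 1 ^ r, 0, ?_⟩
    have : ti * ((-t) ^ (s' + 1) * w ^ r) - (ι₀ ((-1) ^ (s' + 1) * X 0 ^ s' * X 1 ^ r) + t ^ 2 * ι₁ 0) = 0 := by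
      rw [map_mul, map_mul, map_pow, map_pow, map_pow, map_neg, map_one, h0, ← hw, map_zero]
      linear_combination ((-1) ^ (s' + 1) * t ^ s' * w ^ r) * hti
    rw [this]; exact Ideal.zero_mem _

/-- `ti · ι₀(α)` splits for every polynomial `α` (`α = y₀ α₁ + α₀(y₁)`, `ti·ι₀(y₀ α₁) = ι₀ α₁`). -/
private theorem split_ti_mul (hC : ∀ c : k, ι₁ (C c) = ι₀ (C c)) (α : MvPolynomial (Fin 2) k) :
    ∃ α' β : MvPolynomial (Fin 2) k, ti * ι₀ α - (ι₀ α' + t ^ 2 * ι₁ β) ∈ Ideal.span {ι₀ (X 0 + X 1 ^ 2)} := by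
  classical
  have hdm := MvPolynomial.divMonomial_add_modMonomial α (Finsupp.single 0 1)
  set α₁ := MvPolynomial.divMonomial α (Finsupp.single 0 1)
  set α₀ := MvPolynomial.modMonomial α (Finsupp.single 0 1) with hα₀
  have hX : (monomial (Finsupp.single (0 : Fin 2) 1)) (1 : k) = X 0 := rfl
  rw [← hdm, hX]
  have hsplit2 : ti * ι₀ (X 0 * α₁ + α₀) = ti * ι₀ (X 0 * α₁) + ti * ι₀ α₀ := by rw [map_add, mul_add]
  rw [hsplit2]
  refine split_add ι₀ ι₁ t ?_ ?_
  · refine ⟨α₁, 0, ?_⟩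
    have : ti * ι₀ (X 0 * α₁) - (ι₀ α₁ + t ^ 2 * ι₁ 0) = 0 := by
      rw [map_mul, h0, map_zero]; linear_combination (ti * 0 + ι₀ α₁) * hti
    rw [this]; exact Ideal.zero_mem _
  · -- `α₀` is a polynomial in `y₁` alone
    rw [α₀.as_sum, map_sum, Finset.mul_sum]
    refine split_sum ι₀ ι₁ t _ _ fun e he => ?_
    have he0 : e 0 = 0 := by
      by_contra hne
      have hle : Finsupp.single (0 : Fin 2) 1 ≤ e := Finsupp.single_le_iff.2 (Nat.one_le_iff_ne_zero.2 hne)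
      exact (mem_support_iff.1 he) (coeff_modMonomial_of_le _ hle)
    have hee : e = Finsupp.single 1 (e 1) := by
      ext i; fin_cases i
      · simpa using he0
      · simp
    rw [hee, ← C_mul_X_pow_eq_monomial, map_mul, mul_left_comm]
    exact split_C_mul ι₀ ι₁ t hC _ (split_ti_mul_X_pow ι₀ ι₁ t ti h0 h2 h3 hti _)

/-- **THE TWISTED SPLITTING.** If every element of `B` is `ι₀(p)·tiᴺ`, then every `γ ∈ B` is `ι₀ α + t² ι₁ β` modulo `ι₀(y₀ + y₁²)`.
[OURS · L1 W4.5b · D3-8; the ring-level `H¹(ℙ¹, 𝒪(4)) = 0`] -/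
theorem twisted_splitting (hC : ∀ c : k, ι₁ (C c) = ι₀ (C c))
    (hgen : ∀ γ : B, ∃ (N : ℕ) (p : MvPolynomial (Fin 2) k), γ = ι₀ p * ti ^ N) (γ : B) :
    ∃ α β : MvPolynomial (Fin 2) k, γ - (ι₀ α + t ^ 2 * ι₁ β) ∈ Ideal.span {ι₀ (X 0 + X 1 ^ 2)} := by
  obtain ⟨N, p, rfl⟩ := hgen γ
  induction N with
  | zero => exact ⟨p, 0, by simp⟩
  | succ N ih =>
    obtain ⟨α, β, h⟩ := ih
    -- `ι₀ p ti^{N+1} = ti·(ι₀ p tiᴺ − (ι₀ α + t² ι₁ β)) + ti ι₀ α + t² ι₁ (y₀ β)`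
    have hsplit : ∃ α' β' : MvPolynomial (Fin 2) k,
        ti * ι₀ α + t ^ 2 * ι₁ (X 0 * β) - (ι₀ α' + t ^ 2 * ι₁ β') ∈ Ideal.span {ι₀ (X 0 + X 1 ^ 2)} :=
      split_add ι₀ ι₁ t (split_ti_mul ι₀ ι₁ t ti h0 h2 h3 hti hC α) ⟨0, X 0 * β, by simp⟩
    refine split_of_sub_mem ι₀ ι₁ t hsplit ?_
    have : ι₀ p * ti ^ (N + 1) - (ti * ι₀ α + t ^ 2 * ι₁ (X 0 * β)) = ti * (ι₀ p * ti ^ N - (ι₀ α + t ^ 2 * ι₁ β)) := by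
      rw [map_mul, h2]; ring
    rw [this]
    exact Ideal.mul_mem_left _ _ h

/-- The transition of the conic's two dehomogenisations, abstractly: `ι₀(y₀ + y₁²) = t² · ι₁(y₀ + y₁²)`. -/
theorem conic_transition : ι₀ (X 0 + X 1 ^ 2) = t ^ 2 * ι₁ (X 0 + X 1 ^ 2) := by
  rw [map_add, map_add, map_pow, map_pow, h0, h2, h3]
  linear_combination (-(t) - ι₀ (X 1) ^ 2 * (1 + t * ti)) * hti

end Split

/-! ### Part B. The model rings: the two standard charts `D₊(X₀)`, `D₊(X₁)` of `ℙ²_k` read in `(k[X]_{(X₀X₁)})₀` -/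

section Model

open Literature.AlgebraicGeometry.Motives Literature.AlgebraicGeometry.Motives.ProjectiveSpace

variable (k : Type) [Field k]

attribute [local instance] MvPolynomial.gradedAlgebra ProjBaseChange.algebraBase

/-- `X₀X₁` is homogeneous of degree `2`. -/
theorem X01_mem : (X 0 * X 1 : MvPolynomial (Fin 3) k) ∈ MvPolynomial.homogeneousSubmodule (Fin 3) k 2 :=
  SetLike.mul_mem_graded (X_mem 0) (X_mem 1)

/-- `Xᵢ²` is homogeneous of degree `1 • 2`. -/
theorem X_sq_mem (i : Fin 3) : (X i ^ 2 : MvPolynomial (Fin 3) k) ∈ MvPolynomial.homogeneousSubmodule (Fin 3) k (1 • 2) := by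
  simpa using SetLike.pow_mem_graded 2 (X_mem (R := k) (n := 2) i)

/-- `t · ti = 1` in `(k[X]_{(X₀X₁)})₀`: `(X₁²/X₀X₁)·(X₀²/X₀X₁) = 1`. -/
theorem t_mul_ti :
    HomogeneousLocalization.Away.mk _ (X01_mem k) 1 (X 1 ^ 2) (X_sq_mem k 1) *
      HomogeneousLocalization.Away.mk _ (X01_mem k) 1 (X 0 ^ 2) (X_sq_mem k 0) = 1 := by
  rw [HomogeneousLocalization.ext_iff_val, HomogeneousLocalization.val_mul, HomogeneousLocalization.val_one]
  simp only [HomogeneousLocalization.Away.val_mk, Localization.mk_mul]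
  rw [← Localization.mk_one, Localization.mk_eq_mk_iff, Localization.r_iff_exists]
  exact ⟨1, by simp; ring⟩

/-- `ι₀(y₀) = t`: `X₁/X₀ ↦ X₁·X₁/(X₀X₁)`. -/
theorem awayMap₀_toChart_X_zero :
    awayMap (MvPolynomial.homogeneousSubmodule (Fin 3) k) (X_mem 1)
        (rfl : (X 0 * X 1 : MvPolynomial (Fin 3) k) = X 0 * X 1) (toChart k 0 (X 0)) =
      HomogeneousLocalization.Away.mk _ (X01_mem k) 1 (X 1 ^ 2) (X_sq_mem k 1) := by
  rw [toChart, aeval_X, chartGen, HomogeneousLocalization.awayMap_mk, HomogeneousLocalization.ext_iff_val]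
  simp only [HomogeneousLocalization.Away.val_mk]
  rw [Localization.mk_eq_mk_iff, Localization.r_iff_exists]
  exact ⟨1, by simp [Fin.succAbove]; ring⟩

/-- `ι₁(y₀) = ti`: `X₀/X₁ ↦ X₀·X₀/(X₀X₁)`. -/
theorem awayMap₁_toChart_X_zero :
    awayMap (MvPolynomial.homogeneousSubmodule (Fin 3) k) (X_mem 0)
        (mul_comm (X 0 : MvPolynomial (Fin 3) k) (X 1)) (toChart k 1 (X 0)) =
      HomogeneousLocalization.Away.mk _ (X01_mem k) 1 (X 0 ^ 2) (X_sq_mem k 0) := by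
  rw [toChart, aeval_X, chartGen, HomogeneousLocalization.awayMap_mk, HomogeneousLocalization.ext_iff_val]
  simp only [HomogeneousLocalization.Away.val_mk]
  rw [Localization.mk_eq_mk_iff, Localization.r_iff_exists]
  exact ⟨1, by simp [Fin.succAbove]; ring⟩

/-- `ι₁(y₁) = ι₀(y₁) · ti`: `X₂X₀/(X₀X₁) = X₂X₁/(X₀X₁) · X₀²/(X₀X₁)`. -/
theorem awayMap₁_toChart_X_one :
    awayMap (MvPolynomial.homogeneousSubmodule (Fin 3) k) (X_mem 0)
        (mul_comm (X 0 : MvPolynomial (Fin 3) k) (X 1)) (toChart k 1 (X 1)) =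
      awayMap (MvPolynomial.homogeneousSubmodule (Fin 3) k) (X_mem 1)
          (rfl : (X 0 * X 1 : MvPolynomial (Fin 3) k) = X 0 * X 1) (toChart k 0 (X 1)) *
        HomogeneousLocalization.Away.mk _ (X01_mem k) 1 (X 0 ^ 2) (X_sq_mem k 0) := by
  rw [toChart, toChart, aeval_X, aeval_X, chartGen, chartGen, HomogeneousLocalization.awayMap_mk,
    HomogeneousLocalization.awayMap_mk, HomogeneousLocalization.ext_iff_val, HomogeneousLocalization.val_mul]
  simp only [HomogeneousLocalization.Away.val_mk, Localization.mk_mul]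
  rw [Localization.mk_eq_mk_iff, Localization.r_iff_exists]
  exact ⟨1, by simp [Fin.succAbove]; ring⟩

/-- The two charts have the same scalars in the overlap ring. -/
theorem awayMap_toChart_C (c : k) :
    awayMap (MvPolynomial.homogeneousSubmodule (Fin 3) k) (X_mem 0)
        (mul_comm (X 0 : MvPolynomial (Fin 3) k) (X 1)) (toChart k 1 (C c)) =
      awayMap (MvPolynomial.homogeneousSubmodule (Fin 3) k) (X_mem 1)
        (rfl : (X 0 * X 1 : MvPolynomial (Fin 3) k) = X 0 * X 1) (toChart k 0 (C c)) := by
  rw [← MvPolynomial.algebraMap_eq, AlgHom.commutes, AlgHom.commutes, awayMap_algebraMap, awayMap_algebraMap]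

/-- Every element of `(k[X]_{(X₀X₁)})₀` is `ι₀(p) · tiᴺ`: `a/(X₀X₁)ᴺ = (a/X₀²ᴺ)·(X₀²/X₀X₁)ᴺ`, and `a/X₀²ᴺ` is a chart-`0` polynomial. -/
theorem exists_eq_awayMap₀_mul_pow (γ : HomogeneousLocalization.Away (MvPolynomial.homogeneousSubmodule (Fin 3) k)
      (X 0 * X 1 : MvPolynomial (Fin 3) k)) :
    ∃ (N : ℕ) (p : MvPolynomial (Fin 2) k),
      γ = awayMap (MvPolynomial.homogeneousSubmodule (Fin 3) k) (X_mem 1)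
              (rfl : (X 0 * X 1 : MvPolynomial (Fin 3) k) = X 0 * X 1) (toChart k 0 p) *
            HomogeneousLocalization.Away.mk _ (X01_mem k) 1 (X 0 ^ 2) (X_sq_mem k 0) ^ N := by
  obtain ⟨n, a, ha, rfl⟩ := HomogeneousLocalization.Away.mk_surjective _ (X01_mem k) γ
  have ha' : a ∈ MvPolynomial.homogeneousSubmodule (Fin 3) k ((2 * n) • 1) := by
    simpa [smul_eq_mul, mul_comm] using ha
  refine ⟨n, ofChart k 0 (HomogeneousLocalization.Away.mk _ (X_mem 0) (2 * n) a ha'), ?_⟩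
  rw [toChart_ofChart, HomogeneousLocalization.awayMap_mk, HomogeneousLocalization.ext_iff_val,
    HomogeneousLocalization.val_mul, HomogeneousLocalization.val_pow]
  simp only [HomogeneousLocalization.Away.val_mk, Localization.mk_mul, Localization.mk_pow]
  rw [Localization.mk_eq_mk_iff, Localization.r_iff_exists]
  exact ⟨1, by simp; ring⟩

/-! ### Part B′. The conic `F = X₀X₁ + X₂²`: dehomogenisations, primality, the zero locus -/

/-- `F = X₀X₁ + X₂²` is homogeneous of degree `2`. -/
theorem isHomogeneous_conic : (X 0 * X 1 + X 2 ^ 2 : MvPolynomial (Fin 3) k).IsHomogeneous 2 := by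
  have h0 : (X 0 : MvPolynomial (Fin 3) k).IsHomogeneous 1 := isHomogeneous_X k 0
  have h1 : (X 1 : MvPolynomial (Fin 3) k).IsHomogeneous 1 := isHomogeneous_X k 1
  have h2 : (X 2 : MvPolynomial (Fin 3) k).IsHomogeneous 1 := isHomogeneous_X k 2
  exact (h0.mul h1).add (h2.pow 2)

/-- `F(x₀ := 1) = y₀ + y₁²` (chart `D₊(X₀)`, `y₀ = X₁/X₀`, `y₁ = X₂/X₀`). -/
theorem dehomogenize_zero_conic : dehomogenize k 0 (X 0 * X 1 + X 2 ^ 2 : MvPolynomial (Fin 3) k) = X 0 + X 1 ^ 2 := by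
  have h1 : dehomogenize k 0 (X 1 : MvPolynomial (Fin 3) k) = X 0 := by
    simpa using dehomogenize_X_succAbove k (0 : Fin 3) (0 : Fin 2)
  have h2 : dehomogenize k 0 (X 2 : MvPolynomial (Fin 3) k) = X 1 := by
    simpa using dehomogenize_X_succAbove k (0 : Fin 3) (1 : Fin 2)
  rw [map_add, map_mul, map_pow, dehomogenize_X_self, h1, h2, one_mul]

/-- `F(x₁ := 1) = y₀ + y₁²` (chart `D₊(X₁)`, `y₀ = X₀/X₁`, `y₁ = X₂/X₁`). -/
theorem dehomogenize_one_conic : dehomogenize k 1 (X 0 * X 1 + X 2 ^ 2 : MvPolynomial (Fin 3) k) = X 0 + X 1 ^ 2 := by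
  have h0 : dehomogenize k 1 (X 0 : MvPolynomial (Fin 3) k) = X 0 := by
    simpa using dehomogenize_X_succAbove k (1 : Fin 3) (0 : Fin 2)
  have h2 : dehomogenize k 1 (X 2 : MvPolynomial (Fin 3) k) = X 1 := by
    simpa using dehomogenize_X_succAbove k (1 : Fin 3) (1 : Fin 2)
  rw [map_add, map_mul, map_pow, dehomogenize_X_self, h0, h2, mul_one]

/-- The chart equation `F/Xᵢ²` (`i = 0, 1`) is `toChart (y₀ + y₁²)`. -/
theorem chartEqn_conic_eq (i : Fin 3) (hi : i = 0 ∨ i = 1) :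
    SmoothHypersurface.chartEqn (X 0 * X 1 + X 2 ^ 2 : MvPolynomial (Fin 3) k) i (isHomogeneous_conic k) =
      toChart k i (X 0 + X 1 ^ 2) := by
  rw [SmoothHypersurface.chartEqn, isLocalizationElem_X]
  rcases hi with rfl | rfl
  · rw [dehomogenize_zero_conic]
  · rw [dehomogenize_one_conic]

/-- `(y₀ + y₁²)` is a prime ideal of `k[y₀, y₁]` (the kernel of `y₀ ↦ −T²`, `y₁ ↦ T`). -/
theorem isPrime_span_conic : (Ideal.span {(X 0 + X 1 ^ 2 : MvPolynomial (Fin 2) k)}).IsPrime := by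
  have hker := Literature.AlgebraicGeometry.Resolution.ker_aeval_vecCons_X k (-(Polynomial.X) ^ 2)
  have heq : (X 0 - (-(Polynomial.X : Polynomial k) ^ 2).toMvPolynomial 1 : MvPolynomial (Fin 2) k) = X 0 + X 1 ^ 2 := by
    rw [map_neg, map_pow, Polynomial.toMvPolynomial_X]; ring
  rw [heq] at hker
  rw [← hker]
  exact RingHom.ker_isPrime _

/-- `(toChart (y₀ + y₁²))` is a prime ideal of the chart ring `(k[X]_{(Xᵢ)})₀ ≅ k[y₀, y₁]`. -/
theorem isPrime_span_toChart_conic (i : Fin 3) :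
    (Ideal.span {toChart k i (X 0 + X 1 ^ 2 : MvPolynomial (Fin 2) k)}).IsPrime := by
  have h : Ideal.span {toChart k i (X 0 + X 1 ^ 2 : MvPolynomial (Fin 2) k)} =
      Ideal.map (chartAlgEquiv k i).symm (Ideal.span {(X 0 + X 1 ^ 2 : MvPolynomial (Fin 2) k)}) := by
    rw [Ideal.map_span, Set.image_singleton]; rfl
  rw [h]
  haveI := isPrime_span_conic k
  exact Ideal.map_isPrime_of_equiv _

/-- `toChart (y₀ + y₁²) ≠ 0` and the chart ring has no zero divisors: `toChart(y₀+y₁²) · z = 0 ⇒ z = 0`. -/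
theorem eq_zero_of_toChart_conic_mul_eq_zero (i : Fin 3)
    (z : HomogeneousLocalization.Away (MvPolynomial.homogeneousSubmodule (Fin 3) k) (X i : MvPolynomial (Fin 3) k))
    (hz : toChart k i (X 0 + X 1 ^ 2 : MvPolynomial (Fin 2) k) * z = 0) : z = 0 := by
  have h := congrArg (chartAlgEquiv k i) hz
  rw [map_mul, map_zero] at h
  have hne : chartAlgEquiv k i (toChart k i (X 0 + X 1 ^ 2 : MvPolynomial (Fin 2) k)) ≠ 0 := by
    have : chartAlgEquiv k i (toChart k i (X 0 + X 1 ^ 2 : MvPolynomial (Fin 2) k)) = X 0 + X 1 ^ 2 :=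
      (chartAlgEquiv k i).apply_symm_apply _
    rw [this]
    intro h0
    have := congrArg (MvPolynomial.eval ![(1 : k), 0]) h0
    simp at this
  rcases mul_eq_zero.1 h with h' | h'
  · exact absurd h' hne
  · simpa using h'

/-- `V₊(X₀X₁ + X₂²) ⊆ D₊(X₀) ∪ D₊(X₁)`: a point containing `X₀` and `X₁` contains `X₂² = F − X₀X₁`, hence every variable. -/
theorem zeroLocus_conic_subset (p : Proj (MvPolynomial.homogeneousSubmodule (Fin 3) k))
    (hp : p ∈ (SmoothHypersurface.zeroLocusClosed (X 0 * X 1 + X 2 ^ 2 : MvPolynomial (Fin 3) k) : Set _)) :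
    p ∈ ((Proj.basicOpen (MvPolynomial.homogeneousSubmodule (Fin 3) k) (X 0 : MvPolynomial (Fin 3) k) : Set _)) ∪
      ((Proj.basicOpen (MvPolynomial.homogeneousSubmodule (Fin 3) k) (X 1 : MvPolynomial (Fin 3) k) : Set _)) := by
  rw [SmoothHypersurface.coe_zeroLocusClosed, ProjectiveSpectrum.mem_zeroLocus, Set.singleton_subset_iff] at hp
  by_contra h
  rw [Set.mem_union, not_or] at h
  obtain ⟨h0, h1⟩ := h
  have hx0 : (X 0 : MvPolynomial (Fin 3) k) ∈ p.asHomogeneousIdeal := by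
    by_contra h'; exact h0 ((Proj.mem_basicOpen _ _ _).2 h')
  have hx1 : (X 1 : MvPolynomial (Fin 3) k) ∈ p.asHomogeneousIdeal := by
    by_contra h'; exact h1 ((Proj.mem_basicOpen _ _ _).2 h')
  have hx2 : (X 2 : MvPolynomial (Fin 3) k) ∈ p.asHomogeneousIdeal := by
    have hsq : (X 2 : MvPolynomial (Fin 3) k) ^ 2 ∈ p.asHomogeneousIdeal := by
      have : (X 2 : MvPolynomial (Fin 3) k) ^ 2 = (X 0 * X 1 + X 2 ^ 2) - X 0 * X 1 := by ring
      rw [this]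
      exact Ideal.sub_mem _ hp (Ideal.mul_mem_left _ _ hx1)
    exact p.isPrime.mem_of_pow_mem 2 hsq
  obtain ⟨j, hj⟩ := exists_X_notMem (k := k) (n := 2) p
  fin_cases j
  · exact hj hx0
  · exact hj hx1
  · exact hj hx2

end Model

end S10Conic

end Summit.ResolutionOfSingularities.ResolutionOfSingularities.Cruxes.EquisingularLiftNat.Sections

end
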